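/-
Copyright (c) 2026 the pub-hodgecm-mathlib formalisation cell (harness21).  Prover seat hodgecm-mathlib-K2E4-p11 (g8): Track B «K2-LIT»,
#184♮ = hLiu418 = stmt-HodgeConjecture-24832; socket #41 open surface (u-0c), I4 block (desk of record): the GL_n-side letter `hlevN` of I3 ED. 2
`K2LiuSiegelMiddleTermKTypesLevel` (K2Liu-p12) — CONGRUENCE LEVELS ARE STABLE UNDER CONJUGATION BY THE STANDARD MAXIMAL COMPACT.
THEOREMS ONLY (no `def`, no `instance`, no `notation`, no named-fact hypothesis, no `sorry`).
-/
import Literature.NumberTheory.Automorphic.CongruenceSubgroupExpansionGL      -- ★ `conj_mem_congruenceGL` (principal congruence subgroups are normal in `GL_n(𝒪)`)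
import Literature.NumberTheory.Automorphic.GLnFiniteAdeleRestrictedProduct   -- ★ `GLn.evalAt`, `GLn.evalAt_mem_glInt_iff`
import Literature.NumberTheory.Automorphic.GLnAdelicStructureProofs          -- ★ `GLn.ofFinite_sndHom_of_mem`
import Literature.NumberTheory.Automorphic.AdelicVectorHeightCompact         -- ★ `sndHom_mem_of_mem_standardMaximalCompactGL`
import HarnessLib

/-!
# Crux `HLiu418`, socket #41, (u-0c) I4 block — `K2LiuGL2LevelConjugate`: THE `K`-CONJUGATES OF A CONGRUENCE-LEVEL ELEMENT `(1, r)` ARE AGAIN `(1, r′)` WITH `r′` IN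
# THE SAME LEVEL

Cell `hodgecm-mathlib`, crux item hLiu418 = `stmt-HodgeConjecture-24832`; squad K2 ∕ K2Liu (L1, LEAD F0P6-plan (g14)), road `K2_Liu`, socket #41, (u-0c) I4 block
(K2E4-p11 desk of record; consumer I3 ED. 2 `K2LiuSiegelMiddleTermKTypesLevel`, K2Liu-p12, binder `hlevN`).  Lane `--supports stmt-HodgeConjecture-24832 --as helper`
(count-neutral helper; closes no socket by itself).

THE MATHEMATICS [BorelJacquet1979, §4.1], [PlatonovRapinchuk1994, §5.1], [BernsteinZelevinsky1976, §3].  In `GL_n(𝔸_K) = GL_n(K_∞) × GL_n(𝔸_K^∞)` the standard maximal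
compact subgroup is `K = K_∞ · GL_n(𝒪̂_K)`; for `r ∈ GL_n(𝒪̂_K)` in the principal congruence level `{r | r_v ∈ K_v(γ_v), v ∈ S}` and `k ∈ K`, the conjugate
`k⁻¹ · (1, r) · k` equals `(1, k_f⁻¹ r k_f)` (its archimedean component is `k_∞⁻¹ · 1 · k_∞ = 1`, ★ `GLn.ofFinite_sndHom_of_mem`), and `k_f⁻¹ r k_f` lies in the same
level because `k_f ∈ GL_n(𝒪̂_K)` (★ `sndHom_mem_of_mem_standardMaximalCompactGL`) and the principal congruence subgroups `K_v(γ)` are NORMAL in `GL_n(𝒪_v)`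
(★ `conj_mem_congruenceGL`).
* §1 `evalAt_mem_glInt_of_mem` — `r ∈ GL_n(𝒪̂_K) ⇒ r_v ∈ GL_n(𝒪_v)` for every `v`;
* §2 **`exists_level_conj`** — the letter `hlevN`: `∃ r′ ∈ GL_n(𝒪̂_K)`, `r′_v ∈ K_v(γ_v)` (`v ∈ S`), `k⁻¹ · (1, r) · k = (1, r′)`.
HONEST LABEL.  Count-neutral helper; it retires nothing by itself: `HC_CM` is proved only modulo the 7 printed citations (2 remaining named inputs:
hLiu418 = `stmt-HodgeConjecture-24832`, h413 = `stmt-HodgeConjecture-24833`) until rung 0 closes.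

## References
* [BorelJacquet1979] A. Borel, H. Jacquet, *Automorphic forms and automorphic representations*, Corvallis I (1979), §4.1 (`G(𝔸_f)`, levels).
* [PlatonovRapinchuk1994] V. Platonov, A. Rapinchuk, *Algebraic Groups and Number Theory* (1994), §5.1 (`GL_n(𝔸_f)`, congruence subgroups).
* [BernsteinZelevinsky1976] I. N. Bernstein, A. V. Zelevinsky, *Representations of the group GL(n,F) where F is a non-archimedean local field* (1976), §3.
-/

set_option autoImplicit false
set_option linter.dupNamespace false -- the mandated namespace repeats `HodgeConjecture.HodgeConjecture`

noncomputable section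

open NumberField IsDedekindDomain
open Literature.NumberTheory.Automorphic

namespace Summit.HodgeConjecture.HodgeConjecture.Cruxes.HLiu418.K2LiuGL2LevelConjugate

variable {K : Type} [Field K] [NumberField K] {n : ℕ}

/-! ## §1 The components of an element of `GL_n(𝒪̂_K)` are in `GL_n(𝒪_v)` -/

/-- **`r ∈ GL_n(𝒪̂_K) ⇒ r_v ∈ GL_n(𝒪_v)`** for every finite place `v` (entries of `r` and `r⁻¹` are integral at every place).
[cite: PlatonovRapinchuk1994, §5.1] -/
theorem evalAt_mem_glInt_of_mem {r : GL (Fin n) (FiniteAdeleRing (𝓞 K) K)} (hr : r ∈ glFiniteIntegralLevel n K) (v : HeightOneSpectrum (𝓞 K)) :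
    GLn.evalAt n K v r ∈ glInt n (v.adicCompletion K) := by
  rw [GLn.evalAt_mem_glInt_iff]
  obtain ⟨h1, h2⟩ := mem_glFiniteIntegralLevel_iff.1 hr
  exact ⟨fun i j => mem_integralFiniteAdeles_iff.1 (h1 i j) v, fun i j => mem_integralFiniteAdeles_iff.1 (h2 i j) v⟩

/-! ## §2 The letter `hlevN`: conjugating a level element by the standard maximal compact -/

/-- **THE `K`-CONJUGATES OF `(1, r)` STAY IN THE LEVEL.**  For `r ∈ GL_n(𝒪̂_K)` with `r_v ∈ K_v(γ_v)` for `v ∈ S` and `k ∈ K = K_∞ · GL_n(𝒪̂_K)`: there is `r′ ∈ GL_n(𝒪̂_K)`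
with `r′_v ∈ K_v(γ_v)` for `v ∈ S` and `k⁻¹ · (1, r) · k = (1, r′)` — namely `r′ = k_f⁻¹ r k_f` (★ `sndHom_mem_of_mem_standardMaximalCompactGL`, ★ `conj_mem_congruenceGL`,
★ `GLn.ofFinite_sndHom_of_mem`: the conjugate has archimedean component `1`). [cite: BorelJacquet1979, §4.1] [cite: PlatonovRapinchuk1994, §5.1]
[cite: BernsteinZelevinsky1976, §3] -/
theorem exists_level_conj (S : Finset (HeightOneSpectrum (𝓞 K))) (γl : ∀ v : HeightOneSpectrum (𝓞 K), ValuativeRel.ValueGroupWithZero (v.adicCompletion K))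
    {r : GL (Fin n) (FiniteAdeleRing (𝓞 K) K)} (hr : r ∈ glFiniteIntegralLevel n K) (hrS : ∀ v ∈ S, GLn.evalAt n K v r ∈ congruenceGL n (γl v))
    {k : GL (Fin n) (AdeleRing (𝓞 K) K)} (hk : k ∈ standardMaximalCompactGL n K) :
    ∃ r' : GL (Fin n) (FiniteAdeleRing (𝓞 K) K), r' ∈ glFiniteIntegralLevel n K ∧ (∀ v ∈ S, GLn.evalAt n K v r' ∈ congruenceGL n (γl v)) ∧
      k⁻¹ * GLn.ofFinite n K r * k = GLn.ofFinite n K r' := by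
  have hκ : GLn.sndHom n K k ∈ glFiniteIntegralLevel n K := sndHom_mem_of_mem_standardMaximalCompactGL hk
  refine ⟨(GLn.sndHom n K k)⁻¹ * r * GLn.sndHom n K k,
    (glFiniteIntegralLevel n K).mul_mem ((glFiniteIntegralLevel n K).mul_mem ((glFiniteIntegralLevel n K).inv_mem hκ) hr) hκ, fun v hv => ?_, ?_⟩
  · -- the principal congruence subgroup `K_v(γ_v)` is normal in `GL_n(𝒪_v)`
    have h := conj_mem_congruenceGL ((glInt n (v.adicCompletion K)).inv_mem (evalAt_mem_glInt_of_mem hκ v)) (hrS v hv)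
    rw [inv_inv] at h
    rw [map_mul, map_mul, map_inv]
    exact h
  · -- the conjugate has archimedean component `1`, hence is `(1, k_f⁻¹ r k_f)`
    have hmem : k⁻¹ * GLn.ofFinite n K r * k ∈ glIntegralLevel n K := by
      refine mem_glIntegralLevel_iff.2 ⟨?_, ?_⟩
      · rw [map_mul, map_mul, map_inv, GLn.sndHom_ofFinite]
        exact (glFiniteIntegralLevel n K).mul_mem ((glFiniteIntegralLevel n K).mul_mem ((glFiniteIntegralLevel n K).inv_mem hκ) hr) hκ
      · rw [map_mul, map_mul, map_inv, GLn.fstHom_ofFinite, mul_one, inv_mul_cancel]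
    have hs : GLn.sndHom n K (k⁻¹ * GLn.ofFinite n K r * k) = (GLn.sndHom n K k)⁻¹ * r * GLn.sndHom n K k := by
      rw [map_mul, map_mul, map_inv, GLn.sndHom_ofFinite]
    have h := GLn.ofFinite_sndHom_of_mem hmem
    rw [hs] at h
    exact h.symm

end Summit.HodgeConjecture.HodgeConjecture.Cruxes.HLiu418.K2LiuGL2LevelConjugate

end
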